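import Mathlib
import Summits.AtomisticToContinuum.Crystallization.Theses.PhononSlackCertificates
import Summits.AtomisticToContinuum.Crystallization.Theorems.PhononSlackCertificatesNearFarGlueRTorus
import Summits.AtomisticToContinuum.Crystallization.Theorems.PhononSlackCertificatesNearFarGlueRLooseReduction
import Summits.AtomisticToContinuum.Crystallization.Theorems.ExcessDecayLiouvilleCrysEnergyLimit
import Literature.MathematicalPhysics.StatisticalMechanics.LennardJonesClusters
import Literature.Geometry.DiscreteGeometry.TwoShellPatterns

/-!
# Crux `PhononSlackCertificates.NearFarGlueR` (stmt-AtomisticToContinuum-14970), line `Sketch`: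
the residual is a statement about NEAR-MINIMISERS only

Continuation lead c6.  The registered residual `stub_tightContactGap` of the line (every bad
particle within `21/20` of a good particle — a *tight contact* — pays `g₂ > 0` against `N·e*`) was
put in TORUS form by c5 (`tightContactGap_iff_torusTightContactGap`): one `g > 0` with
`e* + g·#T(motif)/#motif ≤ e(P)` for every periodic configuration `P` with `3/10`-separated point
set.  Since the tight-contact DENSITY `#T(motif)/#motif` is at most `1`, the torus inequality is
automatic for every configuration lying `g` or more above `e*` per particle
(`torusTight_ineq_of_le_excess`).  Hence (§1) the residual is EQUIVALENT to its restriction to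
periodic `g`-NEAR-MINIMISERS (`e(P) < e* + g`), for which it reads: the tight-contact density is
at most the energy excess per particle divided by `g` (`torusTightContactGap_iff_nearMin`,
`tightContactGap_iff_nearMin`) — "the excess energy of periodic Lennard-Jones matter controls its
density of good/bad interface LINEARLY", the three-dimensional analogue of the two-dimensional
"energy excess controls defects" estimates.  §2 draws the two necessary conditions a refuter can
aim at: under the residual a periodic GROUND STATE (`e(P) = e*`) with `3/10`-separated point set has
NO tight contact at all — no bad point within `21/20` of a good point
(`forall_not_tight_of_periodicMinimiser`) — and, in the finite form, Lennard-Jones ground states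
`x^N` carry at most `(E(N) − N·e*)/g₂` tight contacts (`card_tight_groundState_le`), hence
`#T(x^N)/N → 0` (`tendsto_card_tight_groundState_div`, with the proved energy limit
`crysEnergyLimit_proof` and the proved uniform minimal distance `LennardJonesMinimalDistance_holds`
— the latter only through injectivity, the residual being separation-free once true,
`tightContact_ineq_of_tightContactGap`).  All `[folklore]`.
-/

noncomputable section

namespace Summit.AtomisticToContinuum.Crystallization.Theorems.PhononSlackCertificatesNearFarGlueR

open Literature.MathematicalPhysics.StatisticalMechanics
open Literature.Geometry.DiscreteGeometry
open Summit.AtomisticToContinuum.Crystallization.Theses.PhononSlackCertificates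
open scoped BigOperators Classical
open Filter Topology

/-! ## §1 The torus form restricted to near-minimisers -/

/-- The tight contacts of the motif are a sub-finset of the motif: their density is at most `1`.
[folklore] -/
theorem card_tight_filter_le_card_motif (P : PeriodicConfiguration 3) :
    ((P.motif.filter fun y => ¬ IsTwoShellGoodSet (1 / 20) (47 / 50) 1 P.points y ∧
        ∃ z ∈ P.points, IsTwoShellGoodSet (1 / 20) (47 / 50) 1 P.points z ∧
          dist z y ≤ 21 / 20).card : ℝ) ≤ (P.motif.card : ℝ) := by
  exact_mod_cast Finset.card_filter_le _ _

/-- **A configuration `g` above `e*` per particle satisfies the torus inequality outright**: if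
`e* + g ≤ e(P)` and `g ≥ 0` then `e* + g·#T(motif)/#motif ≤ e(P)` (the density is at most `1`).
[folklore] -/
theorem torusTight_ineq_of_le_excess (P : PeriodicConfiguration 3) {g : ℝ} (hg : 0 ≤ g)
    (h : (⨅ Q : PeriodicConfiguration 3, Q.energyPerParticle lennardJones) + g ≤
      P.energyPerParticle lennardJones) :
    (⨅ Q : PeriodicConfiguration 3, Q.energyPerParticle lennardJones)
        + g * ((P.motif.filter fun y => ¬ IsTwoShellGoodSet (1 / 20) (47 / 50) 1 P.points y ∧
            ∃ z ∈ P.points, IsTwoShellGoodSet (1 / 20) (47 / 50) 1 P.points z ∧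
              dist z y ≤ 21 / 20).card : ℝ) / (P.motif.card : ℝ)
        ≤ P.energyPerParticle lennardJones := by
  have hm : (0 : ℝ) < P.motif.card := by exact_mod_cast P.motif_nonempty.card_pos
  have hd : ((P.motif.filter fun y => ¬ IsTwoShellGoodSet (1 / 20) (47 / 50) 1 P.points y ∧
        ∃ z ∈ P.points, IsTwoShellGoodSet (1 / 20) (47 / 50) 1 P.points z ∧
          dist z y ≤ 21 / 20).card : ℝ) / (P.motif.card : ℝ) ≤ 1 := by
    rw [div_le_one hm]
    exact card_tight_filter_le_card_motif P
  have h0 : (0 : ℝ) ≤ ((P.motif.filter fun y => ¬ IsTwoShellGoodSet (1 / 20) (47 / 50) 1 P.points y ∧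
        ∃ z ∈ P.points, IsTwoShellGoodSet (1 / 20) (47 / 50) 1 P.points z ∧
          dist z y ≤ 21 / 20).card : ℝ) / (P.motif.card : ℝ) := by positivity
  have hmul : g * ((P.motif.filter fun y => ¬ IsTwoShellGoodSet (1 / 20) (47 / 50) 1 P.points y ∧
        ∃ z ∈ P.points, IsTwoShellGoodSet (1 / 20) (47 / 50) 1 P.points z ∧
          dist z y ≤ 21 / 20).card : ℝ) / (P.motif.card : ℝ) ≤ g := by
    rw [mul_div_assoc]
    exact mul_le_of_le_one_right hg hd
  linarith

/-- **Torus form ⟺ near-minimiser form.**  One `g > 0` charges every periodic configuration with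
`3/10`-separated point set `g` per tight contact per cell above `e*` iff one `g > 0` does so for
the periodic `g`-NEAR-MINIMISERS (`e(P) < e* + g`) among them; for those the inequality says that
the tight-contact density is at most `(e(P) − e*)/g`. [folklore] -/
theorem torusTightContactGap_iff_nearMin :
    (∃ g : ℝ, 0 < g ∧ ∀ P : PeriodicConfiguration 3,
      (∀ u ∈ P.points, ∀ v ∈ P.points, u ≠ v → (3 / 10 : ℝ) ≤ dist u v) →
      (⨅ Q : PeriodicConfiguration 3, Q.energyPerParticle lennardJones)
        + g * ((P.motif.filter fun y => ¬ IsTwoShellGoodSet (1 / 20) (47 / 50) 1 P.points y ∧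
            ∃ z ∈ P.points, IsTwoShellGoodSet (1 / 20) (47 / 50) 1 P.points z ∧
              dist z y ≤ 21 / 20).card : ℝ) / (P.motif.card : ℝ)
        ≤ P.energyPerParticle lennardJones) ↔
    (∃ g : ℝ, 0 < g ∧ ∀ P : PeriodicConfiguration 3,
      (∀ u ∈ P.points, ∀ v ∈ P.points, u ≠ v → (3 / 10 : ℝ) ≤ dist u v) →
      P.energyPerParticle lennardJones <
        (⨅ Q : PeriodicConfiguration 3, Q.energyPerParticle lennardJones) + g →
      (⨅ Q : PeriodicConfiguration 3, Q.energyPerParticle lennardJones)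
        + g * ((P.motif.filter fun y => ¬ IsTwoShellGoodSet (1 / 20) (47 / 50) 1 P.points y ∧
            ∃ z ∈ P.points, IsTwoShellGoodSet (1 / 20) (47 / 50) 1 P.points z ∧
              dist z y ≤ 21 / 20).card : ℝ) / (P.motif.card : ℝ)
        ≤ P.energyPerParticle lennardJones) := by
  constructor
  · rintro ⟨g, hg, H⟩
    exact ⟨g, hg, fun P hsep _ => H P hsep⟩
  · rintro ⟨g, hg, H⟩
    refine ⟨g, hg, fun P hsep => ?_⟩
    by_cases hnear : P.energyPerParticle lennardJones <
        (⨅ Q : PeriodicConfiguration 3, Q.energyPerParticle lennardJones) + g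
    · exact H P hsep hnear
    · exact torusTight_ineq_of_le_excess P hg.le (not_lt.1 hnear)

/-- **The registered residual ⟺ its near-minimiser form**: the tight contact gap (`∀ δ > 0 ∃ g₂ …`,
the one open stub of the line) holds iff one `g > 0` bounds the tight-contact density of every
periodic `g`-near-minimiser with `3/10`-separated point set by its energy excess per particle
over `e*`, divided by `g`.  Everything else in the residual is automatic. [folklore] -/
theorem tightContactGap_iff_nearMin :
    (∀ δ : ℝ, 0 < δ → ∃ g₂ : ℝ, 0 < g₂ ∧ ∀ (N : ℕ) (x : Fin N → EuclideanSpace ℝ (Fin 3)),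
      (∀ i j : Fin N, i ≠ j → δ ≤ dist (x i) (x j)) →
      (N : ℝ) * (⨅ Q : PeriodicConfiguration 3, Q.energyPerParticle lennardJones)
        + g₂ * (Nat.card {j : Fin N // ¬ IsTwoShellGood (1 / 20) (47 / 50) 1 x j ∧
            ∃ i : Fin N, IsTwoShellGood (1 / 20) (47 / 50) 1 x i ∧ dist (x i) (x j) ≤ 21 / 20} : ℝ)
        ≤ interactionEnergy lennardJones x) ↔
    (∃ g : ℝ, 0 < g ∧ ∀ P : PeriodicConfiguration 3,
      (∀ u ∈ P.points, ∀ v ∈ P.points, u ≠ v → (3 / 10 : ℝ) ≤ dist u v) →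
      P.energyPerParticle lennardJones <
        (⨅ Q : PeriodicConfiguration 3, Q.energyPerParticle lennardJones) + g →
      (⨅ Q : PeriodicConfiguration 3, Q.energyPerParticle lennardJones)
        + g * ((P.motif.filter fun y => ¬ IsTwoShellGoodSet (1 / 20) (47 / 50) 1 P.points y ∧
            ∃ z ∈ P.points, IsTwoShellGoodSet (1 / 20) (47 / 50) 1 P.points z ∧
              dist z y ≤ 21 / 20).card : ℝ) / (P.motif.card : ℝ)
        ≤ P.energyPerParticle lennardJones) :=
  tightContactGap_iff_torusTightContactGap.trans torusTightContactGap_iff_nearMin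


/-- **Registered sub-goal `stub_nearMinForm` of the line `Sketch`** (the statement of
`tightContactGap_iff_nearMin`). [folklore] -/
theorem stub_nearMinForm :
    (∀ δ : ℝ, 0 < δ → ∃ g₂ : ℝ, 0 < g₂ ∧ ∀ (N : ℕ) (x : Fin N → EuclideanSpace ℝ (Fin 3)),
      (∀ i j : Fin N, i ≠ j → δ ≤ dist (x i) (x j)) →
      (N : ℝ) * (⨅ Q : PeriodicConfiguration 3, Q.energyPerParticle lennardJones)
        + g₂ * (Nat.card {j : Fin N // ¬ IsTwoShellGood (1 / 20) (47 / 50) 1 x j ∧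
            ∃ i : Fin N, IsTwoShellGood (1 / 20) (47 / 50) 1 x i ∧ dist (x i) (x j) ≤ 21 / 20} : ℝ)
        ≤ interactionEnergy lennardJones x) ↔
    (∃ g : ℝ, 0 < g ∧ ∀ P : PeriodicConfiguration 3,
      (∀ u ∈ P.points, ∀ v ∈ P.points, u ≠ v → (3 / 10 : ℝ) ≤ dist u v) →
      P.energyPerParticle lennardJones <
        (⨅ Q : PeriodicConfiguration 3, Q.energyPerParticle lennardJones) + g →
      (⨅ Q : PeriodicConfiguration 3, Q.energyPerParticle lennardJones)
        + g * ((P.motif.filter fun y => ¬ IsTwoShellGoodSet (1 / 20) (47 / 50) 1 P.points y ∧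
            ∃ z ∈ P.points, IsTwoShellGoodSet (1 / 20) (47 / 50) 1 P.points z ∧
              dist z y ≤ 21 / 20).card : ℝ) / (P.motif.card : ℝ)
        ≤ P.energyPerParticle lennardJones) :=
  tightContactGap_iff_nearMin

/-! ## §2 Necessary conditions: (near-)minimisers under the residual -/

/-- **Under the torus inequality with constant `g`, the number of tight contacts per cell is at most
`#motif · (e(P) − e*)/g`.** [folklore] -/
theorem card_tight_le_of_torusTight {g : ℝ} (hg : 0 < g) (P : PeriodicConfiguration 3)
    (h : (⨅ Q : PeriodicConfiguration 3, Q.energyPerParticle lennardJones)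
        + g * ((P.motif.filter fun y => ¬ IsTwoShellGoodSet (1 / 20) (47 / 50) 1 P.points y ∧
            ∃ z ∈ P.points, IsTwoShellGoodSet (1 / 20) (47 / 50) 1 P.points z ∧
              dist z y ≤ 21 / 20).card : ℝ) / (P.motif.card : ℝ)
        ≤ P.energyPerParticle lennardJones) :
    ((P.motif.filter fun y => ¬ IsTwoShellGoodSet (1 / 20) (47 / 50) 1 P.points y ∧
        ∃ z ∈ P.points, IsTwoShellGoodSet (1 / 20) (47 / 50) 1 P.points z ∧
          dist z y ≤ 21 / 20).card : ℝ) ≤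
      (P.motif.card : ℝ) * (P.energyPerParticle lennardJones -
        (⨅ Q : PeriodicConfiguration 3, Q.energyPerParticle lennardJones)) / g := by
  have hm : (0 : ℝ) < P.motif.card := by exact_mod_cast P.motif_nonempty.card_pos
  rw [le_div_iff₀ hg]
  have h1 : g * ((P.motif.filter fun y => ¬ IsTwoShellGoodSet (1 / 20) (47 / 50) 1 P.points y ∧
      ∃ z ∈ P.points, IsTwoShellGoodSet (1 / 20) (47 / 50) 1 P.points z ∧
        dist z y ≤ 21 / 20).card : ℝ) ≤ (P.motif.card : ℝ) * (P.energyPerParticle lennardJones -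
        (⨅ Q : PeriodicConfiguration 3, Q.energyPerParticle lennardJones)) := by
    have h2 := mul_le_mul_of_nonneg_left
      (sub_nonneg.2 h) hm.le
    have h3 : (P.motif.card : ℝ) * (g * ((P.motif.filter fun y =>
        ¬ IsTwoShellGoodSet (1 / 20) (47 / 50) 1 P.points y ∧ ∃ z ∈ P.points,
          IsTwoShellGoodSet (1 / 20) (47 / 50) 1 P.points z ∧ dist z y ≤ 21 / 20).card : ℝ) /
            (P.motif.card : ℝ)) = g * ((P.motif.filter fun y =>
        ¬ IsTwoShellGoodSet (1 / 20) (47 / 50) 1 P.points y ∧ ∃ z ∈ P.points,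
          IsTwoShellGoodSet (1 / 20) (47 / 50) 1 P.points z ∧ dist z y ≤ 21 / 20).card : ℝ) := by
      field_simp
    nlinarith [h2, h3]
  linarith

/-- **A periodic ground state has no tight contact** (necessary condition of the residual in torus
form): if the torus inequality holds with some `g > 0` for `P`, and `P` realises the periodic
infimum, `e(P) = e*`, then no bad point of `P` lies within `21/20` of a good point of `P` — every
`21/20`-connected cluster of the point set is entirely good or entirely bad. [folklore] -/
theorem forall_not_tight_of_torusTight_of_isMin {g : ℝ} (hg : 0 < g) (P : PeriodicConfiguration 3)
    (h : (⨅ Q : PeriodicConfiguration 3, Q.energyPerParticle lennardJones)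
        + g * ((P.motif.filter fun y => ¬ IsTwoShellGoodSet (1 / 20) (47 / 50) 1 P.points y ∧
            ∃ z ∈ P.points, IsTwoShellGoodSet (1 / 20) (47 / 50) 1 P.points z ∧
              dist z y ≤ 21 / 20).card : ℝ) / (P.motif.card : ℝ)
        ≤ P.energyPerParticle lennardJones)
    (hmin : P.energyPerParticle lennardJones =
      (⨅ Q : PeriodicConfiguration 3, Q.energyPerParticle lennardJones)) :
    ∀ y ∈ P.points, ¬ IsTwoShellGoodSet (1 / 20) (47 / 50) 1 P.points y →
      ∀ z ∈ P.points, IsTwoShellGoodSet (1 / 20) (47 / 50) 1 P.points z → (21 / 20 : ℝ) < dist z y := by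
  -- the motif carries no tight contact
  have hcard := card_tight_le_of_torusTight hg P h
  rw [hmin, sub_self, mul_zero, zero_div] at hcard
  have hzero : (P.motif.filter fun y => ¬ IsTwoShellGoodSet (1 / 20) (47 / 50) 1 P.points y ∧
      ∃ z ∈ P.points, IsTwoShellGoodSet (1 / 20) (47 / 50) 1 P.points z ∧
        dist z y ≤ 21 / 20).card = 0 := by
    have : ((P.motif.filter fun y => ¬ IsTwoShellGoodSet (1 / 20) (47 / 50) 1 P.points y ∧
      ∃ z ∈ P.points, IsTwoShellGoodSet (1 / 20) (47 / 50) 1 P.points z ∧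
        dist z y ≤ 21 / 20).card : ℝ) = 0 := le_antisymm hcard (Nat.cast_nonneg _)
    exact_mod_cast this
  rw [Finset.card_eq_zero, Finset.filter_eq_empty_iff] at hzero
  -- transport from the motif to every point by the lattice of periods (goodness is invariant
  -- under the translations `· + g`, which map the point set onto itself)
  intro y hy hbad z hz hgood
  obtain ⟨y₀, hy₀, g₀, hg₀, rfl⟩ := hy
  by_contra hle
  have hle : dist z (y₀ + g₀) ≤ 21 / 20 := not_lt.1 hle
  refine hzero hy₀ ⟨?_, z - g₀, ?_, ?_, ?_⟩
  · -- badness of `y₀` from badness of `y₀ + g₀`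
    intro hgood₀
    exact hbad (isTwoShellGoodSet_add_of_mem_lattice P hg₀ hgood₀)
  · have : z - g₀ = z + (-g₀) := sub_eq_add_neg z g₀
    rw [this]
    exact P.add_mem_points hz (P.lattice.neg_mem hg₀)
  · have h1 := isTwoShellGoodSet_add_of_mem_lattice P (P.lattice.neg_mem hg₀) hgood
    simpa [sub_eq_add_neg] using h1
  · have : dist (z - g₀) y₀ = dist z (y₀ + g₀) := by
      rw [dist_eq_norm, dist_eq_norm]
      congr 1
      abel
    rw [this]
    exact hle
where
  /-- Set-goodness is invariant under the translations by periods. [folklore] -/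
  isTwoShellGoodSet_add_of_mem_lattice (P : PeriodicConfiguration 3) {g₀ : EuclideanSpace ℝ (Fin 3)}
      (hg₀ : g₀ ∈ P.lattice) {q : EuclideanSpace ℝ (Fin 3)}
      (hq : IsTwoShellGoodSet (1 / 20) (47 / 50) 1 P.points q) :
      IsTwoShellGoodSet (1 / 20) (47 / 50) 1 P.points (q + g₀) := by
    obtain ⟨a, ha₁, ha₂, A, Pat, f, hPat, hf, hinj, hcov⟩ := hq
    refine ⟨a, ha₁, ha₂, A, Pat, fun v => f v + g₀, hPat, fun v hv => ⟨?_, ?_⟩, ?_, ?_⟩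
    · exact P.add_mem_points (hf v hv).1 hg₀
    · have : dist (f v + g₀) (q + g₀ + a • A v) = dist (f v) (q + a • A v) := by
        rw [dist_eq_norm, dist_eq_norm]
        congr 1
        abel
      rw [this]
      exact (hf v hv).2
    · intro v hv w hw hvw
      exact hinj hv hw (add_right_cancel hvw)
    · intro y hy hyq hd
      have hy' : y - g₀ ∈ P.points := by
        have : y - g₀ = y + (-g₀) := sub_eq_add_neg y g₀
        rw [this]
        exact P.add_mem_points hy (P.lattice.neg_mem hg₀)
      have hne : y - g₀ ≠ q := by
        intro h; apply hyq; rw [← h]; abel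
      have hd' : dist (y - g₀) q ≤ 3 / 2 * a := by
        have : dist (y - g₀) q = dist y (q + g₀) := by
          rw [dist_eq_norm, dist_eq_norm]
          congr 1
          abel
        rw [this]; exact hd
      obtain ⟨v, hv, hfv⟩ := hcov (y - g₀) hy' hne hd'
      exact ⟨v, hv, by simp only [hfv, sub_add_cancel]⟩

/-- **Under the residual (torus form), periodic ground states with `3/10`-separated point set are
tight-contact-free.** [folklore] -/
theorem forall_not_tight_of_periodicMinimiser
    (H : ∃ g : ℝ, 0 < g ∧ ∀ P : PeriodicConfiguration 3,
      (∀ u ∈ P.points, ∀ v ∈ P.points, u ≠ v → (3 / 10 : ℝ) ≤ dist u v) →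
      (⨅ Q : PeriodicConfiguration 3, Q.energyPerParticle lennardJones)
        + g * ((P.motif.filter fun y => ¬ IsTwoShellGoodSet (1 / 20) (47 / 50) 1 P.points y ∧
            ∃ z ∈ P.points, IsTwoShellGoodSet (1 / 20) (47 / 50) 1 P.points z ∧
              dist z y ≤ 21 / 20).card : ℝ) / (P.motif.card : ℝ)
        ≤ P.energyPerParticle lennardJones)
    (P : PeriodicConfiguration 3)
    (hsep : ∀ u ∈ P.points, ∀ v ∈ P.points, u ≠ v → (3 / 10 : ℝ) ≤ dist u v)
    (hmin : IsLeast (Set.range fun Q : PeriodicConfiguration 3 => Q.energyPerParticle lennardJones)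
      (P.energyPerParticle lennardJones)) :
    ∀ y ∈ P.points, ¬ IsTwoShellGoodSet (1 / 20) (47 / 50) 1 P.points y →
      ∀ z ∈ P.points, IsTwoShellGoodSet (1 / 20) (47 / 50) 1 P.points z → (21 / 20 : ℝ) < dist z y := by
  obtain ⟨g, hg, Hg⟩ := H
  exact forall_not_tight_of_torusTight_of_isMin hg P (Hg P hsep) hmin.csInf_eq.symm

/-- **Finite form: ground states carry at most `(E(N) − N·e*)/g₂` tight contacts.**  Under the
registered residual there is one `g₂ > 0` such that for every `N` and every Lennard-Jones ground
state `x` of `N` particles, `#T(x) ≤ (E(N) − N·e*)/g₂` (ground states are injective; the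
residual, once true, needs no separation: `tightContact_ineq_of_tightContactGap`). [folklore] -/
theorem card_tight_groundState_le
    (h : ∀ δ : ℝ, 0 < δ → ∃ g₂ : ℝ, 0 < g₂ ∧ ∀ (N : ℕ) (x : Fin N → EuclideanSpace ℝ (Fin 3)),
      (∀ i j : Fin N, i ≠ j → δ ≤ dist (x i) (x j)) →
      (N : ℝ) * (⨅ Q : PeriodicConfiguration 3, Q.energyPerParticle lennardJones)
        + g₂ * (Nat.card {j : Fin N // ¬ IsTwoShellGood (1 / 20) (47 / 50) 1 x j ∧
            ∃ i : Fin N, IsTwoShellGood (1 / 20) (47 / 50) 1 x i ∧ dist (x i) (x j) ≤ 21 / 20} : ℝ)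
        ≤ interactionEnergy lennardJones x) :
    ∃ g₂ : ℝ, 0 < g₂ ∧ ∀ (N : ℕ) (x : Fin N → EuclideanSpace ℝ (Fin 3)),
      IsGroundState lennardJones x →
      (Nat.card {j : Fin N // ¬ IsTwoShellGood (1 / 20) (47 / 50) 1 x j ∧
          ∃ i : Fin N, IsTwoShellGood (1 / 20) (47 / 50) 1 x i ∧ dist (x i) (x j) ≤ 21 / 20} : ℝ) ≤
        (groundStateEnergy lennardJones 3 N -
          (N : ℝ) * (⨅ Q : PeriodicConfiguration 3, Q.energyPerParticle lennardJones)) / g₂ := by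
  obtain ⟨g₂, hg₂, H⟩ := tightContact_ineq_of_tightContactGap h
  refine ⟨g₂, hg₂, fun N x hx => ?_⟩
  have h1 := H N x hx.1
  rw [hx.2] at h1
  rw [le_div_iff₀ hg₂]
  linarith

/-- **Under the residual, the tight contacts of Lennard-Jones ground states are `o(N)`**: for
every sequence of ground states `x^N`, `#T(x^N)/N → 0` (from `card_tight_groundState_le` and the
proved energy limit `E(N)/N → e*`, `crysEnergyLimit_proof`). [folklore] -/
theorem tendsto_card_tight_groundState_div
    (h : ∀ δ : ℝ, 0 < δ → ∃ g₂ : ℝ, 0 < g₂ ∧ ∀ (N : ℕ) (x : Fin N → EuclideanSpace ℝ (Fin 3)),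
      (∀ i j : Fin N, i ≠ j → δ ≤ dist (x i) (x j)) →
      (N : ℝ) * (⨅ Q : PeriodicConfiguration 3, Q.energyPerParticle lennardJones)
        + g₂ * (Nat.card {j : Fin N // ¬ IsTwoShellGood (1 / 20) (47 / 50) 1 x j ∧
            ∃ i : Fin N, IsTwoShellGood (1 / 20) (47 / 50) 1 x i ∧ dist (x i) (x j) ≤ 21 / 20} : ℝ)
        ≤ interactionEnergy lennardJones x)
    (x : (N : ℕ) → (Fin N → EuclideanSpace ℝ (Fin 3)))
    (hx : ∀ N, IsGroundState lennardJones (x N)) :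
    Tendsto (fun N : ℕ => (Nat.card {j : Fin N // ¬ IsTwoShellGood (1 / 20) (47 / 50) 1 (x N) j ∧
        ∃ i : Fin N, IsTwoShellGood (1 / 20) (47 / 50) 1 (x N) i ∧ dist (x N i) (x N j) ≤ 21 / 20} : ℝ) /
          (N : ℝ)) atTop (𝓝 0) := by
  obtain ⟨g₂, hg₂, H⟩ := card_tight_groundState_le h
  set eStar := (⨅ Q : PeriodicConfiguration 3, Q.energyPerParticle lennardJones) with heStar
  -- the proved energy limit `E(N)/N → e*`
  have hlim : Tendsto (fun N : ℕ => groundStateEnergy lennardJones 3 N / N) atTop (𝓝 eStar) := by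
    have h0 := Summit.AtomisticToContinuum.Crystallization.Theorems.crysEnergyLimit_proof
    unfold Summit.AtomisticToContinuum.Crystallization.Theses.ExcessDecayLiouville.CrysEnergyLimit at h0
    exact h0
  -- upper envelope `(E(N)/N − e*)/g₂ → 0`
  have hupper : Tendsto (fun N : ℕ => (groundStateEnergy lennardJones 3 N / N - eStar) / g₂)
      atTop (𝓝 0) := by
    have h1 : Tendsto (fun N : ℕ => groundStateEnergy lennardJones 3 N / N - eStar) atTop (𝓝 0) := by
      have := hlim.sub_const eStar
      simpa using this
    have h2 := h1.div_const g₂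
    simpa using h2
  refine tendsto_of_tendsto_of_tendsto_of_le_of_le' tendsto_const_nhds hupper
    (Eventually.of_forall fun N => by positivity) ?_
  filter_upwards [eventually_gt_atTop 0] with N hN
  have hN : (0 : ℝ) < N := by exact_mod_cast hN
  have hb := H N (x N) (hx N)
  have heq : ((groundStateEnergy lennardJones 3 N - ↑N * eStar) / g₂) / ↑N =
      (groundStateEnergy lennardJones 3 N / ↑N - eStar) / g₂ := by
    field_simp
  calc _ ≤ ((groundStateEnergy lennardJones 3 N - ↑N * eStar) / g₂) / ↑N :=
        div_le_div_of_nonneg_right hb hN.le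
    _ = _ := heq

/-! ## §3 Appendix (c6): the near-minimiser gap closes the crux and splits the target -/

/-- **Near-minimiser gap ⇒ the crux** (the `--by` theorem once the promoted statement is an item). [folklore] -/
theorem nearFarGlueR_of_nearMinGap
    (h : (∃ g : ℝ, 0 < g ∧ ∀ P : PeriodicConfiguration 3,
      (∀ u ∈ P.points, ∀ v ∈ P.points, u ≠ v → (3 / 10 : ℝ) ≤ dist u v) →
      P.energyPerParticle lennardJones <
        (⨅ Q : PeriodicConfiguration 3, Q.energyPerParticle lennardJones) + g →
      (⨅ Q : PeriodicConfiguration 3, Q.energyPerParticle lennardJones)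
        + g * ((P.motif.filter fun y => ¬ IsTwoShellGoodSet (1 / 20) (47 / 50) 1 P.points y ∧
            ∃ z ∈ P.points, IsTwoShellGoodSet (1 / 20) (47 / 50) 1 P.points z ∧
              dist z y ≤ 21 / 20).card : ℝ) / (P.motif.card : ℝ)
        ≤ P.energyPerParticle lennardJones)) :
    NearFarGlueR :=
  nearFarGlueR_of_tightContactGap (tightContactGap_iff_nearMin.2 h)

/-- **The target in near-minimiser terms**: `CoerciveTwoShellGap ↔ AllBadGap ∧ near-minimiser gap`. [folklore] -/
theorem coerciveTwoShellGap_iff_allBadGap_and_nearMinGap :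
    CoerciveTwoShellGap ↔ AllBadGap ∧
      (∃ g : ℝ, 0 < g ∧ ∀ P : PeriodicConfiguration 3,
      (∀ u ∈ P.points, ∀ v ∈ P.points, u ≠ v → (3 / 10 : ℝ) ≤ dist u v) →
      P.energyPerParticle lennardJones <
        (⨅ Q : PeriodicConfiguration 3, Q.energyPerParticle lennardJones) + g →
      (⨅ Q : PeriodicConfiguration 3, Q.energyPerParticle lennardJones)
        + g * ((P.motif.filter fun y => ¬ IsTwoShellGoodSet (1 / 20) (47 / 50) 1 P.points y ∧
            ∃ z ∈ P.points, IsTwoShellGoodSet (1 / 20) (47 / 50) 1 P.points z ∧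
              dist z y ≤ 21 / 20).card : ℝ) / (P.motif.card : ℝ)
        ≤ P.energyPerParticle lennardJones) := by
  rw [coerciveTwoShellGap_iff_allBadGap_and_tightContactGap, tightContactGap_iff_nearMin]

/-- **Registered sub-goal `stub_nearMinCloses`**: the near-minimiser gap implies the crux. [folklore] -/
theorem stub_nearMinCloses :
    (∃ g : ℝ, 0 < g ∧ ∀ P : PeriodicConfiguration 3,
      (∀ u ∈ P.points, ∀ v ∈ P.points, u ≠ v → (3 / 10 : ℝ) ≤ dist u v) →
      P.energyPerParticle lennardJones <
        (⨅ Q : PeriodicConfiguration 3, Q.energyPerParticle lennardJones) + g →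
      (⨅ Q : PeriodicConfiguration 3, Q.energyPerParticle lennardJones)
        + g * ((P.motif.filter fun y => ¬ IsTwoShellGoodSet (1 / 20) (47 / 50) 1 P.points y ∧
            ∃ z ∈ P.points, IsTwoShellGoodSet (1 / 20) (47 / 50) 1 P.points z ∧
              dist z y ≤ 21 / 20).card : ℝ) / (P.motif.card : ℝ)
        ≤ P.energyPerParticle lennardJones) →
    NearFarGlueR :=
  nearFarGlueR_of_nearMinGap

end Summit.AtomisticToContinuum.Crystallization.Theorems.PhononSlackCertificatesNearFarGlueR

end
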